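import Summits.Ventures.YMGap.RobustBall.RobustAreaLawPairW
import Summits.Ventures.YMGap.RobustBall.AreaLawRowsPair
import HarnessLib

/-!
# Venture YMGap, track Y2 ROBUST-BALL — `SU(3)` AREA-LAW ROWS ON THE TIER-2 (diameter-weighted) BALL through the Holley–Stroock PAIR door,
# on the cell's certified pairs, `d = 4` and `d = 3`

HONEST FRAMING.  Venture file of the cell `pub-ymgap` (QuantumFields programme), seat engine-2 (g7).  Strong-coupling LATTICE
statements only: `SU(3)` lattice Yang–Mills on the tori `(ℤ/L)^d` (uniform in `L`), Wilson's action at tree coupling `β_W/3` plus a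
member of rb-theory's TIER-2 ball `ClusterDomain κ ε₀ ε₁` (infinite horizontal range, `e^{κ·diam}`-weighted loads) with vertical dependence
diameter `mv`; conclusion = Wilson's AREA LAW for rectangular loops, constants uniform on the ball (`RobustBall.AreaLawOnBallW`, rb-theory's
reserved W-twin of `AreaLawOnBall`).  Nothing about the continuum, an infinite-volume string tension, weak coupling, a mass gap, or Clay.
Kernel ARITHMETIC over ds-4's `RobustBall.areaLawOnBallW_of_pair` — the tier-2 twin of engine-2's pair slab door `areaLawOnBall_of_pair`
(Holley–Stroock one-link step, NO self-Lipschitz load, cross leg `√(e^{ε₀} c)`), weighted row condition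
`e^{κ/n}·e^{ε₀}·2n|β/N|√(c v) + √(e^{ε₀} c)·ε₁ < 1` — on the cell's CERTIFIED `SU(3)` pairs P11 (H1 `OneLinkPoincareSUN 3 (3/5) (4/5)` + H2
`OneLinkVarianceBound 3 (11/30) (49/20)`, `√(cv) = 7/5`) and P35 (H1 + H2′ `OneLinkVarianceBound 3 (3/5) (17/5)`, `√(cv) = √68/5 ≤ 1.6493`);
NOTHING asserted about H1/H2/H2′ — the rows are K-conditional on the displayed pair (classes «K × C(H1) × C-iv(H2)» / «K × C(H1) × C⁻(H2′)»),
never K.  Hypothesis-free `SU(3)` pair rows (Bakry–Émery pair): `AreaLawRowsSU3FreePair`; every `N`: ds-4's `RobustAreaLawPairW`.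

THE ROWS (currency `AreaLawOnBallW 3 d (β_W/3) κ (2ε) ε mv` FOR EVERY vertical diameter `mv ≥ 1`, no range cut-off; one-parameter convention
`ε₀ = 2ε`, `ε₁ = ε`, `1/1000` granularity rounded down; exact rational certificates with `e^x ≤ T(x) = 1 + x + x²/2 + x³/6 + (5/96)x⁴` on `[0,1]`,
`√(e^{2ε}c) = e^ε √c`, `√(4/5) ≤ 0.8945`, `√68/5 ≤ 1.6493`, `(6/5)^{1/3} ≤ 1.0627`, `(6/5)^{1/2} ≤ 1.0955`, `(3/2)^{1/3} ≤ 1.1448`):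
* `d = 4`, `κ = log(6/5)`: P11 `(β⋆_W, ε) = (1/4, .370) (1/3, .312) (9/20, .241) (1/2, .214) (11/20, .188)`; P35 `(3/5, .115) (2/3, .082) (3/4, .044)
  (4/5, .023)`; `κ = log(3/2)`: P11 `(1/3, .295) (1/2, .194)` — against the TIER-1 pair rows `(1/4, .381) (1/3, .325) (9/20, .257) (1/2, .230)
  (11/20, .205) | (3/5, .134) (2/3, .102) (3/4, .064) (4/5, .043)` of `AreaLawRowsPair` (the weight costs `≤ .02` in `ε` at `κ = log(6/5)`), and
  against the tier-2 VERTEX rows `(1/3, .245) (1/2, .145) (3/4, .024)` of `AreaLawRowsSU3W`.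
* `d = 3`, `κ = log(6/5)`: P11 `(1/2, .305) (3/4, .206) (33/40, .180)`; P35 `(9/10, .106) (1, .073) (6/5, .012)`.
These are the `SU(3)` entries of §5 row 3g («tier-2 area law, pair column») of HOME/rb/ROBUST-BALL-STATEMENT.md, previously empty.
-/

noncomputable section

open MeasureTheory ProbabilityTheory Real
open Literature.MathematicalPhysics.QuantumFieldTheory
open Summit.QuantumFields.BalabanUV.InfraRed.StrongCouplingPoincareDoorSUN (OneLinkPoincareSUN OneLinkPoincareSUN.mono)
open Summit.QuantumFields.BalabanUV.InfraRed.StrongCouplingVarianceDoorSUN (OneLinkVarianceBound)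
open Summit.Ventures.YMGap.RobustBall
  (AreaLawOnBallW areaLawOnBallW_of_pair exp_log_six_fifths_div_three_le exp_log_three_halves_div_three_le
    exp_log_six_fifths_div_two_le)
open Summit.Ventures.YMGap.RobustBallSU3 (exp_le_taylor4 sqrt_four_fifths_le)

namespace Summit.Ventures.YMGap.RobustBallPair

variable {n : ℕ}

/-! ### 1. The weighted Holley–Stroock row sum under the Taylor majorant -/

/-- The WEIGHTED Holley–Stroock row sum under the majorants: for `0 ≤ ε ≤ 1/2`, `0 ≤ A ≤ A'`, `√c ≤ s₀`, `e^{w} ≤ E_w`,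
`e^{w}(e^{2ε}A) + √(e^{2ε}c)·ε ≤ E_w(T(2ε)A') + T(ε)s₀ε`. [folklore] -/
theorem hs_rowsumW_majorant {ε A A' c s₀ w Ew : ℝ} (hε0 : 0 ≤ ε) (hε1 : ε ≤ 1 / 2) (hA0 : 0 ≤ A) (hA : A ≤ A')
    (hs : Real.sqrt c ≤ s₀) (hEw : exp w ≤ Ew) :
    exp w * (exp (2 * ε) * A) + Real.sqrt (exp (2 * ε) * c) * ε ≤
      Ew * ((1 + 2 * ε + (2 * ε) ^ 2 / 2 + (2 * ε) ^ 3 / 6 + 5 / 96 * (2 * ε) ^ 4) * A') +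
        (1 + ε + ε ^ 2 / 2 + ε ^ 3 / 6 + 5 / 96 * ε ^ 4) * s₀ * ε := by
  have h1 : exp (2 * ε) * A ≤ (1 + 2 * ε + (2 * ε) ^ 2 / 2 + (2 * ε) ^ 3 / 6 + 5 / 96 * (2 * ε) ^ 4) * A' :=
    mul_le_mul (exp_le_taylor4 (by linarith) (by linarith)) hA hA0 (by positivity)
  have h2 : Real.sqrt (exp (2 * ε) * c) * ε ≤ (1 + ε + ε ^ 2 / 2 + ε ^ 3 / 6 + 5 / 96 * ε ^ 4) * s₀ * ε := by
    rw [sqrt_exp_two_mul_mul]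
    exact mul_le_mul_of_nonneg_right
      (mul_le_mul (exp_le_taylor4 hε0 (by linarith)) hs (Real.sqrt_nonneg _) (by positivity)) hε0
  have h3 : exp w * (exp (2 * ε) * A) ≤ Ew * ((1 + 2 * ε + (2 * ε) ^ 2 / 2 + (2 * ε) ^ 3 / 6 + 5 / 96 * (2 * ε) ^ 4) * A') :=
    mul_le_mul hEw h1 (by positivity) ((exp_pos _).le.trans hEw)
  linarith

/-! ### 2. `SU(3)`: the tier-2 pair door on a symbolic pair and on the certified pairs, every `d = n + 1` -/

/-- **`SU(3)`, every `d = n + 1`: TIER-2 AREA LAW ON THE BALL through the pair door** — GIVEN `OneLinkPoincareSUN 3 R c` and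
`OneLinkVarianceBound 3 R v` (`0 ≤ c, v`, `R ≥ 2n|β_W|/9`), `n ≥ 1`, `κ > 0`, the weighted row condition
`e^{κ/n}(e^{ε₀}·2n(|β_W|/9)√(cv)) + √(e^{ε₀}c)·ε₁ < 1` gives `AreaLawOnBallW 3 (n+1) (β_W/3) κ ε₀ ε₁ mv` for every `mv ≥ 1`. [folklore] -/
theorem su3_areaLawOnBallWHS_of_pair {R c v βW κ ε₀ ε₁ : ℝ} (hc : 0 ≤ c) (hv : 0 ≤ v)
    (hP : OneLinkPoincareSUN 3 R c) (hV : OneLinkVarianceBound 3 R v) (hn : 1 ≤ n) (hR : |βW| / 9 * (2 * (n : ℝ)) ≤ R)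
    (hκ : 0 < κ) {mv : ℕ} (hmv : 1 ≤ mv)
    (hrow : exp (κ / n) * (exp ε₀ * (2 * (n : ℝ) * (|βW| / 9) * Real.sqrt (c * v))) + Real.sqrt (exp ε₀ * c) * ε₁ < 1) :
    AreaLawOnBallW 3 (n + 1) (βW / 3) κ ε₀ ε₁ mv := by
  have habs : |βW / 3 / ((3 : ℕ) : ℝ)| = |βW| / 9 := by
    rw [Nat.cast_ofNat, div_div, abs_div, abs_of_pos (by norm_num : (0 : ℝ) < 3 * 3)]; norm_num
  refine areaLawOnBallW_of_pair (n := n) (by norm_num) hn (βW / 3) hc hv hP hV ?_ hκ hmv ?_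
  · rw [habs]; exact hR
  · rw [habs]; exact hrow

/-- **`SU(3)`, `d = 4`, P11, tier 2, one-parameter row schema**: `0 ≤ β_W ≤ 11/20`, `κ > 0` with `e^{κ/3} ≤ E_w`, `0 ≤ ε ≤ 1/2`,
`E_w(T(2ε)(14/15)β_W) + T(ε)·0.8945·ε < 1` ⇒ `AreaLawOnBallW 3 4 (β_W/3) κ (2ε) ε mv` GIVEN H1, H2. [folklore] -/
theorem su3_hsRowW4 {mv : ℕ} (hmv : 1 ≤ mv) (hP : OneLinkPoincareSUN 3 (3 / 5) (4 / 5))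
    (hV : OneLinkVarianceBound 3 (11 / 30) (49 / 20)) {βW κ ε Ew : ℝ} (hβ0 : 0 ≤ βW) (hβ : βW ≤ 11 / 20) (hκ : 0 < κ)
    (hEw : exp (κ / 3) ≤ Ew) (hε0 : 0 ≤ ε) (hε1 : ε ≤ 1 / 2)
    (hcert : Ew * ((1 + 2 * ε + (2 * ε) ^ 2 / 2 + (2 * ε) ^ 3 / 6 + 5 / 96 * (2 * ε) ^ 4) * (14 / 15 * βW)) +
      (1 + ε + ε ^ 2 / 2 + ε ^ 3 / 6 + 5 / 96 * ε ^ 4) * 0.8945 * ε < 1) :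
    AreaLawOnBallW 3 4 (βW / 3) κ (2 * ε) ε mv := by
  show AreaLawOnBallW 3 (3 + 1) (βW / 3) κ (2 * ε) ε mv
  have e : 2 * ((3 : ℕ) : ℝ) * (|βW| / 9) * Real.sqrt (4 / 5 * (49 / 20)) = 14 / 15 * βW := by
    have hsq : Real.sqrt (4 / 5 * (49 / 20)) = 7 / 5 := by
      rw [show (4 / 5 * (49 / 20) : ℝ) = (7 / 5) ^ 2 by norm_num, Real.sqrt_sq (by norm_num)]
    rw [abs_of_nonneg hβ0, hsq]; push_cast; ring
  have hw : exp (κ / ((3 : ℕ) : ℝ)) = exp (κ / 3) := by push_cast; rfl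
  refine su3_areaLawOnBallWHS_of_pair (n := 3) (by norm_num) (by norm_num) (hP.mono (by norm_num) le_rfl) hV (by norm_num)
    (by rw [abs_of_nonneg hβ0]; push_cast; linarith) hκ hmv (lt_of_le_of_lt ?_ hcert)
  rw [e, hw]
  exact hs_rowsumW_majorant hε0 hε1 (by positivity) le_rfl sqrt_four_fifths_le hEw

/-- **`SU(3)`, `d = 4`, P35, tier 2, one-parameter row schema**: `0 ≤ β_W ≤ 9/10`, `κ > 0` with `e^{κ/3} ≤ E_w`, `0 ≤ ε ≤ 1/2`,
`E_w(T(2ε)(2/3)(1.6493)β_W) + T(ε)·0.8945·ε < 1` ⇒ `AreaLawOnBallW 3 4 (β_W/3) κ (2ε) ε mv` GIVEN H1, H2′. [folklore] -/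
theorem su3_hsRowW4' {mv : ℕ} (hmv : 1 ≤ mv) (hP : OneLinkPoincareSUN 3 (3 / 5) (4 / 5))
    (hV : OneLinkVarianceBound 3 (3 / 5) (17 / 5)) {βW κ ε Ew : ℝ} (hβ0 : 0 ≤ βW) (hβ : βW ≤ 9 / 10) (hκ : 0 < κ)
    (hEw : exp (κ / 3) ≤ Ew) (hε0 : 0 ≤ ε) (hε1 : ε ≤ 1 / 2)
    (hcert : Ew * ((1 + 2 * ε + (2 * ε) ^ 2 / 2 + (2 * ε) ^ 3 / 6 + 5 / 96 * (2 * ε) ^ 4) * (2 / 3 * 1.6493 * βW)) +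
      (1 + ε + ε ^ 2 / 2 + ε ^ 3 / 6 + 5 / 96 * ε ^ 4) * 0.8945 * ε < 1) :
    AreaLawOnBallW 3 4 (βW / 3) κ (2 * ε) ε mv := by
  show AreaLawOnBallW 3 (3 + 1) (βW / 3) κ (2 * ε) ε mv
  have e : 2 * ((3 : ℕ) : ℝ) * (|βW| / 9) * Real.sqrt (4 / 5 * (17 / 5)) = 2 / 3 * βW * Real.sqrt (4 / 5 * (17 / 5)) := by
    rw [abs_of_nonneg hβ0]; push_cast; ring
  have hw : exp (κ / ((3 : ℕ) : ℝ)) = exp (κ / 3) := by push_cast; rfl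
  refine su3_areaLawOnBallWHS_of_pair (n := 3) (by norm_num) (by norm_num) hP hV (by norm_num)
    (by rw [abs_of_nonneg hβ0]; push_cast; linarith) hκ hmv (lt_of_le_of_lt ?_ hcert)
  rw [e, hw]
  have hsq35 : Real.sqrt (4 / 5 * (17 / 5)) ≤ 1.6493 := by
    rw [show (1.6493 : ℝ) = Real.sqrt (1.6493 ^ 2) by rw [Real.sqrt_sq (by norm_num)]]
    exact Real.sqrt_le_sqrt (by norm_num)
  exact hs_rowsumW_majorant hε0 hε1 (by positivity) (by nlinarith [hsq35]) sqrt_four_fifths_le hEw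

/-- **`SU(3)`, `d = 3`, P11, tier 2, row schema** (`β_W ≤ 33/40`, `e^{κ/2} ≤ E_w`): `E_w(T(2ε)(28/45)β_W) + T(ε)·0.8945·ε < 1` ⇒
`AreaLawOnBallW 3 3 (β_W/3) κ (2ε) ε mv` GIVEN H1, H2. [folklore] -/
theorem su3_hsRowW3 {mv : ℕ} (hmv : 1 ≤ mv) (hP : OneLinkPoincareSUN 3 (3 / 5) (4 / 5))
    (hV : OneLinkVarianceBound 3 (11 / 30) (49 / 20)) {βW κ ε Ew : ℝ} (hβ0 : 0 ≤ βW) (hβ : βW ≤ 33 / 40) (hκ : 0 < κ)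
    (hEw : exp (κ / 2) ≤ Ew) (hε0 : 0 ≤ ε) (hε1 : ε ≤ 1 / 2)
    (hcert : Ew * ((1 + 2 * ε + (2 * ε) ^ 2 / 2 + (2 * ε) ^ 3 / 6 + 5 / 96 * (2 * ε) ^ 4) * (28 / 45 * βW)) +
      (1 + ε + ε ^ 2 / 2 + ε ^ 3 / 6 + 5 / 96 * ε ^ 4) * 0.8945 * ε < 1) :
    AreaLawOnBallW 3 3 (βW / 3) κ (2 * ε) ε mv := by
  show AreaLawOnBallW 3 (2 + 1) (βW / 3) κ (2 * ε) ε mv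
  have e : 2 * ((2 : ℕ) : ℝ) * (|βW| / 9) * Real.sqrt (4 / 5 * (49 / 20)) = 28 / 45 * βW := by
    have hsq : Real.sqrt (4 / 5 * (49 / 20)) = 7 / 5 := by
      rw [show (4 / 5 * (49 / 20) : ℝ) = (7 / 5) ^ 2 by norm_num, Real.sqrt_sq (by norm_num)]
    rw [abs_of_nonneg hβ0, hsq]; push_cast; ring
  have hw : exp (κ / ((2 : ℕ) : ℝ)) = exp (κ / 2) := by push_cast; rfl
  refine su3_areaLawOnBallWHS_of_pair (n := 2) (by norm_num) (by norm_num) (hP.mono (by norm_num) le_rfl) hV (by norm_num)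
    (by rw [abs_of_nonneg hβ0]; push_cast; linarith) hκ hmv (lt_of_le_of_lt ?_ hcert)
  rw [e, hw]
  exact hs_rowsumW_majorant hε0 hε1 (by positivity) le_rfl sqrt_four_fifths_le hEw

/-- **`SU(3)`, `d = 3`, P35, tier 2, row schema** (`β_W ≤ 27/20`, `e^{κ/2} ≤ E_w`): `E_w(T(2ε)(4/9)(1.6493)β_W) + T(ε)·0.8945·ε < 1` ⇒
`AreaLawOnBallW 3 3 (β_W/3) κ (2ε) ε mv` GIVEN H1, H2′. [folklore] -/
theorem su3_hsRowW3' {mv : ℕ} (hmv : 1 ≤ mv) (hP : OneLinkPoincareSUN 3 (3 / 5) (4 / 5))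
    (hV : OneLinkVarianceBound 3 (3 / 5) (17 / 5)) {βW κ ε Ew : ℝ} (hβ0 : 0 ≤ βW) (hβ : βW ≤ 27 / 20) (hκ : 0 < κ)
    (hEw : exp (κ / 2) ≤ Ew) (hε0 : 0 ≤ ε) (hε1 : ε ≤ 1 / 2)
    (hcert : Ew * ((1 + 2 * ε + (2 * ε) ^ 2 / 2 + (2 * ε) ^ 3 / 6 + 5 / 96 * (2 * ε) ^ 4) * (4 / 9 * 1.6493 * βW)) +
      (1 + ε + ε ^ 2 / 2 + ε ^ 3 / 6 + 5 / 96 * ε ^ 4) * 0.8945 * ε < 1) :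
    AreaLawOnBallW 3 3 (βW / 3) κ (2 * ε) ε mv := by
  show AreaLawOnBallW 3 (2 + 1) (βW / 3) κ (2 * ε) ε mv
  have e : 2 * ((2 : ℕ) : ℝ) * (|βW| / 9) * Real.sqrt (4 / 5 * (17 / 5)) = 4 / 9 * βW * Real.sqrt (4 / 5 * (17 / 5)) := by
    rw [abs_of_nonneg hβ0]; push_cast; ring
  have hw : exp (κ / ((2 : ℕ) : ℝ)) = exp (κ / 2) := by push_cast; rfl
  refine su3_areaLawOnBallWHS_of_pair (n := 2) (by norm_num) (by norm_num) hP hV (by norm_num)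
    (by rw [abs_of_nonneg hβ0]; push_cast; linarith) hκ hmv (lt_of_le_of_lt ?_ hcert)
  rw [e, hw]
  have hsq35 : Real.sqrt (4 / 5 * (17 / 5)) ≤ 1.6493 := by
    rw [show (1.6493 : ℝ) = Real.sqrt (1.6493 ^ 2) by rw [Real.sqrt_sq (by norm_num)]]
    exact Real.sqrt_le_sqrt (by norm_num)
  exact hs_rowsumW_majorant hε0 hε1 (by positivity) (by nlinarith [hsq35]) sqrt_four_fifths_le hEw

/-! ### 3. `d = 4` rows -/

/-- Row `(β⋆_W, κ, ε) = (1/4, log(6/5), 0.370)`, `d = 4`, tier 2, pair door, on P11: `AreaLawOnBallW 3 4 ((1/4)/3) (log(6/5)) 0.74 0.37 mv`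
(tier 1: `0.381`). [folklore] -/
theorem su3_hsRowW4_1_4_w65 {mv : ℕ} (hmv : 1 ≤ mv) (hP : OneLinkPoincareSUN 3 (3 / 5) (4 / 5))
    (hV : OneLinkVarianceBound 3 (11 / 30) (49 / 20)) :
    AreaLawOnBallW 3 4 ((1 / 4 : ℝ) / 3) (Real.log (6 / 5)) (2 * (37 / 100)) (37 / 100) mv :=
  su3_hsRowW4 hmv hP hV (by norm_num) (by norm_num) (Real.log_pos (by norm_num)) exp_log_six_fifths_div_three_le
    (by norm_num) (by norm_num) (by norm_num)

/-- Row `(1/3, log(6/5), 0.312)`, `d = 4`, tier 2, pair door, on P11 (tier 1: `0.325`; tier-2 vertex: `0.245`). [folklore] -/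
theorem su3_hsRowW4_1_3_w65 {mv : ℕ} (hmv : 1 ≤ mv) (hP : OneLinkPoincareSUN 3 (3 / 5) (4 / 5))
    (hV : OneLinkVarianceBound 3 (11 / 30) (49 / 20)) :
    AreaLawOnBallW 3 4 ((1 / 3 : ℝ) / 3) (Real.log (6 / 5)) (2 * (39 / 125)) (39 / 125) mv :=
  su3_hsRowW4 hmv hP hV (by norm_num) (by norm_num) (Real.log_pos (by norm_num)) exp_log_six_fifths_div_three_le
    (by norm_num) (by norm_num) (by norm_num)

/-- Row `(9/20, log(6/5), 0.241)`, `d = 4`, tier 2, pair door, on P11 (tier 1: `0.257`). [folklore] -/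
theorem su3_hsRowW4_9_20_w65 {mv : ℕ} (hmv : 1 ≤ mv) (hP : OneLinkPoincareSUN 3 (3 / 5) (4 / 5))
    (hV : OneLinkVarianceBound 3 (11 / 30) (49 / 20)) :
    AreaLawOnBallW 3 4 ((9 / 20 : ℝ) / 3) (Real.log (6 / 5)) (2 * (241 / 1000)) (241 / 1000) mv :=
  su3_hsRowW4 hmv hP hV (by norm_num) (by norm_num) (Real.log_pos (by norm_num)) exp_log_six_fifths_div_three_le
    (by norm_num) (by norm_num) (by norm_num)

/-- Row `(1/2, log(6/5), 0.214)`, `d = 4`, tier 2, pair door, on P11 (tier 1: `0.230`; tier-2 vertex: `0.145`). [folklore] -/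
theorem su3_hsRowW4_1_2_w65 {mv : ℕ} (hmv : 1 ≤ mv) (hP : OneLinkPoincareSUN 3 (3 / 5) (4 / 5))
    (hV : OneLinkVarianceBound 3 (11 / 30) (49 / 20)) :
    AreaLawOnBallW 3 4 ((1 / 2 : ℝ) / 3) (Real.log (6 / 5)) (2 * (107 / 500)) (107 / 500) mv :=
  su3_hsRowW4 hmv hP hV (by norm_num) (by norm_num) (Real.log_pos (by norm_num)) exp_log_six_fifths_div_three_le
    (by norm_num) (by norm_num) (by norm_num)

/-- Row `(11/20, log(6/5), 0.188)`, `d = 4`, tier 2, pair door, on P11 — the radius cap of P11 (tier 1: `0.205`). [folklore] -/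
theorem su3_hsRowW4_11_20_w65 {mv : ℕ} (hmv : 1 ≤ mv) (hP : OneLinkPoincareSUN 3 (3 / 5) (4 / 5))
    (hV : OneLinkVarianceBound 3 (11 / 30) (49 / 20)) :
    AreaLawOnBallW 3 4 ((11 / 20 : ℝ) / 3) (Real.log (6 / 5)) (2 * (47 / 250)) (47 / 250) mv :=
  su3_hsRowW4 hmv hP hV (by norm_num) (by norm_num) (Real.log_pos (by norm_num)) exp_log_six_fifths_div_three_le
    (by norm_num) (by norm_num) (by norm_num)

/-- Row `(1/3, log(3/2), 0.295)`, `d = 4`, tier 2, HEAVIER weight, pair door, on P11. [folklore] -/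
theorem su3_hsRowW4_1_3_w32 {mv : ℕ} (hmv : 1 ≤ mv) (hP : OneLinkPoincareSUN 3 (3 / 5) (4 / 5))
    (hV : OneLinkVarianceBound 3 (11 / 30) (49 / 20)) :
    AreaLawOnBallW 3 4 ((1 / 3 : ℝ) / 3) (Real.log (3 / 2)) (2 * (59 / 200)) (59 / 200) mv :=
  su3_hsRowW4 hmv hP hV (by norm_num) (by norm_num) (Real.log_pos (by norm_num)) exp_log_three_halves_div_three_le
    (by norm_num) (by norm_num) (by norm_num)

/-- Row `(1/2, log(3/2), 0.194)`, `d = 4`, tier 2, heavier weight, pair door, on P11. [folklore] -/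
theorem su3_hsRowW4_1_2_w32 {mv : ℕ} (hmv : 1 ≤ mv) (hP : OneLinkPoincareSUN 3 (3 / 5) (4 / 5))
    (hV : OneLinkVarianceBound 3 (11 / 30) (49 / 20)) :
    AreaLawOnBallW 3 4 ((1 / 2 : ℝ) / 3) (Real.log (3 / 2)) (2 * (97 / 500)) (97 / 500) mv :=
  su3_hsRowW4 hmv hP hV (by norm_num) (by norm_num) (Real.log_pos (by norm_num)) exp_log_three_halves_div_three_le
    (by norm_num) (by norm_num) (by norm_num)

/-- Row `(3/5, log(6/5), 0.115)`, `d = 4`, tier 2, pair door, on P35 (tier 1: `0.134`). [folklore] -/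
theorem su3_hsRowW4_3_5_w65 {mv : ℕ} (hmv : 1 ≤ mv) (hP : OneLinkPoincareSUN 3 (3 / 5) (4 / 5))
    (hV : OneLinkVarianceBound 3 (3 / 5) (17 / 5)) :
    AreaLawOnBallW 3 4 ((3 / 5 : ℝ) / 3) (Real.log (6 / 5)) (2 * (23 / 200)) (23 / 200) mv :=
  su3_hsRowW4' hmv hP hV (by norm_num) (by norm_num) (Real.log_pos (by norm_num)) exp_log_six_fifths_div_three_le
    (by norm_num) (by norm_num) (by norm_num)

/-- Row `(2/3, log(6/5), 0.082)`, `d = 4`, tier 2, pair door, on P35 (tier 1: `0.102`). [folklore] -/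
theorem su3_hsRowW4_2_3_w65 {mv : ℕ} (hmv : 1 ≤ mv) (hP : OneLinkPoincareSUN 3 (3 / 5) (4 / 5))
    (hV : OneLinkVarianceBound 3 (3 / 5) (17 / 5)) :
    AreaLawOnBallW 3 4 ((2 / 3 : ℝ) / 3) (Real.log (6 / 5)) (2 * (41 / 500)) (41 / 500) mv :=
  su3_hsRowW4' hmv hP hV (by norm_num) (by norm_num) (Real.log_pos (by norm_num)) exp_log_six_fifths_div_three_le
    (by norm_num) (by norm_num) (by norm_num)

/-- Row `(3/4, log(6/5), 0.044)`, `d = 4`, tier 2, pair door, on P35 (tier 1: `0.064`; tier-2 vertex: `0.024`). [folklore] -/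
theorem su3_hsRowW4_3_4_w65 {mv : ℕ} (hmv : 1 ≤ mv) (hP : OneLinkPoincareSUN 3 (3 / 5) (4 / 5))
    (hV : OneLinkVarianceBound 3 (3 / 5) (17 / 5)) :
    AreaLawOnBallW 3 4 ((3 / 4 : ℝ) / 3) (Real.log (6 / 5)) (2 * (11 / 250)) (11 / 250) mv :=
  su3_hsRowW4' hmv hP hV (by norm_num) (by norm_num) (Real.log_pos (by norm_num)) exp_log_six_fifths_div_three_le
    (by norm_num) (by norm_num) (by norm_num)

/-- Row `(4/5, log(6/5), 0.023)`, `d = 4`, tier 2, pair door, on P35 (tier 1: `0.043`). [folklore] -/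
theorem su3_hsRowW4_4_5_w65 {mv : ℕ} (hmv : 1 ≤ mv) (hP : OneLinkPoincareSUN 3 (3 / 5) (4 / 5))
    (hV : OneLinkVarianceBound 3 (3 / 5) (17 / 5)) :
    AreaLawOnBallW 3 4 ((4 / 5 : ℝ) / 3) (Real.log (6 / 5)) (2 * (23 / 1000)) (23 / 1000) mv :=
  su3_hsRowW4' hmv hP hV (by norm_num) (by norm_num) (Real.log_pos (by norm_num)) exp_log_six_fifths_div_three_le
    (by norm_num) (by norm_num) (by norm_num)

/-! ### 4. `d = 3` rows -/

/-- Row `(1/2, log(6/5), 0.305)`, `d = 3`, tier 2, pair door, on P11: `AreaLawOnBallW 3 3 ((1/2)/3) (log(6/5)) 0.61 0.305 mv` (tier 1: `0.325`).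
[folklore] -/
theorem su3_hsRowW3_1_2_w65 {mv : ℕ} (hmv : 1 ≤ mv) (hP : OneLinkPoincareSUN 3 (3 / 5) (4 / 5))
    (hV : OneLinkVarianceBound 3 (11 / 30) (49 / 20)) :
    AreaLawOnBallW 3 3 ((1 / 2 : ℝ) / 3) (Real.log (6 / 5)) (2 * (61 / 200)) (61 / 200) mv :=
  su3_hsRowW3 hmv hP hV (by norm_num) (by norm_num) (Real.log_pos (by norm_num)) exp_log_six_fifths_div_two_le
    (by norm_num) (by norm_num) (by norm_num)

/-- Row `(3/4, log(6/5), 0.206)`, `d = 3`, tier 2, pair door, on P11 (tier 1: `0.230`). [folklore] -/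
theorem su3_hsRowW3_3_4_w65 {mv : ℕ} (hmv : 1 ≤ mv) (hP : OneLinkPoincareSUN 3 (3 / 5) (4 / 5))
    (hV : OneLinkVarianceBound 3 (11 / 30) (49 / 20)) :
    AreaLawOnBallW 3 3 ((3 / 4 : ℝ) / 3) (Real.log (6 / 5)) (2 * (103 / 500)) (103 / 500) mv :=
  su3_hsRowW3 hmv hP hV (by norm_num) (by norm_num) (Real.log_pos (by norm_num)) exp_log_six_fifths_div_two_le
    (by norm_num) (by norm_num) (by norm_num)

/-- Row `(33/40, log(6/5), 0.180)`, `d = 3`, tier 2, pair door, on P11 — the radius cap of P11 at `d = 3` (tier 1: `0.205`). [folklore] -/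
theorem su3_hsRowW3_33_40_w65 {mv : ℕ} (hmv : 1 ≤ mv) (hP : OneLinkPoincareSUN 3 (3 / 5) (4 / 5))
    (hV : OneLinkVarianceBound 3 (11 / 30) (49 / 20)) :
    AreaLawOnBallW 3 3 ((33 / 40 : ℝ) / 3) (Real.log (6 / 5)) (2 * (9 / 50)) (9 / 50) mv :=
  su3_hsRowW3 hmv hP hV (by norm_num) (by norm_num) (Real.log_pos (by norm_num)) exp_log_six_fifths_div_two_le
    (by norm_num) (by norm_num) (by norm_num)

/-- Row `(9/10, log(6/5), 0.106)`, `d = 3`, tier 2, pair door, on P35 (tier 1: `0.134`). [folklore] -/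
theorem su3_hsRowW3_9_10_w65 {mv : ℕ} (hmv : 1 ≤ mv) (hP : OneLinkPoincareSUN 3 (3 / 5) (4 / 5))
    (hV : OneLinkVarianceBound 3 (3 / 5) (17 / 5)) :
    AreaLawOnBallW 3 3 ((9 / 10 : ℝ) / 3) (Real.log (6 / 5)) (2 * (53 / 500)) (53 / 500) mv :=
  su3_hsRowW3' hmv hP hV (by norm_num) (by norm_num) (Real.log_pos (by norm_num)) exp_log_six_fifths_div_two_le
    (by norm_num) (by norm_num) (by norm_num)

/-- Row `(1, log(6/5), 0.073)`, `d = 3`, tier 2, pair door, on P35 (tier 1: `0.102`). [folklore] -/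
theorem su3_hsRowW3_1_w65 {mv : ℕ} (hmv : 1 ≤ mv) (hP : OneLinkPoincareSUN 3 (3 / 5) (4 / 5))
    (hV : OneLinkVarianceBound 3 (3 / 5) (17 / 5)) :
    AreaLawOnBallW 3 3 ((1 : ℝ) / 3) (Real.log (6 / 5)) (2 * (73 / 1000)) (73 / 1000) mv :=
  su3_hsRowW3' hmv hP hV (by norm_num) (by norm_num) (Real.log_pos (by norm_num)) exp_log_six_fifths_div_two_le
    (by norm_num) (by norm_num) (by norm_num)

/-- Row `(6/5, log(6/5), 0.012)`, `d = 3`, tier 2, pair door, on P35 (tier 1: `0.043`) — the last grid coupling inside the weighted door.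
[folklore] -/
theorem su3_hsRowW3_6_5_w65 {mv : ℕ} (hmv : 1 ≤ mv) (hP : OneLinkPoincareSUN 3 (3 / 5) (4 / 5))
    (hV : OneLinkVarianceBound 3 (3 / 5) (17 / 5)) :
    AreaLawOnBallW 3 3 ((6 / 5 : ℝ) / 3) (Real.log (6 / 5)) (2 * (3 / 250)) (3 / 250) mv :=
  su3_hsRowW3' hmv hP hV (by norm_num) (by norm_num) (Real.log_pos (by norm_num)) exp_log_six_fifths_div_two_le
    (by norm_num) (by norm_num) (by norm_num)

/-! ### 5. Numbers -/

/-- Numbers at one glance: `(7/5)² = (4/5)(49/20)`, `1.6493² ≥ (4/5)(17/5)`, `0.8945² ≥ 4/5`; weight majorants `1.0627³ ≥ 6/5`, `1.0955² ≥ 6/5`,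
`1.1448³ ≥ 3/2`; and the weighted `ε = 0` door values at the radius caps, `1.0627·(2/3)(1.6493)(9/10) > 1` but `1.0627·(2/3)(1.6493)(4/5) < 1`
(`d = 4`: the weighted P35 door closes between `β_W = 4/5` and `9/10`), `1.0955·(4/9)(1.6493)(6/5) < 1` (`d = 3`). [folklore] -/
theorem hsRowsW_numbers :
    (7 / 5 : ℝ) ^ 2 = 4 / 5 * (49 / 20) ∧ (1.6493 : ℝ) ^ 2 ≥ 4 / 5 * (17 / 5) ∧ (0.8945 : ℝ) ^ 2 ≥ 4 / 5 ∧
      (1.0627 : ℝ) ^ 3 ≥ 6 / 5 ∧ (1.0955 : ℝ) ^ 2 ≥ 6 / 5 ∧ (1.1448 : ℝ) ^ 3 ≥ 3 / 2 ∧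
      (1.0627 : ℝ) * (2 / 3 * 1.6493 * (9 / 10)) > 1 ∧ (1.0627 : ℝ) * (2 / 3 * 1.6493 * (4 / 5)) < 1 ∧
      (1.0955 : ℝ) * (4 / 9 * 1.6493 * (6 / 5)) < 1 := by
  norm_num

end Summit.Ventures.YMGap.RobustBallPair

end
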